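import Summits.AtomisticToContinuum.Crystallization.Theorems.OverbindingBudgetAffineCushionCut
import Literature.MathematicalPhysics.StatisticalMechanics.BarlowCouplingDecay

/-!
(SPLIT FOR THE 400-LINE CAP by the landing lane, hand-2 g36: this file = part 1 of 3; sequels `…OverbindingBudgetAffineTwinCutB`, `…OverbindingBudgetAffineTwinCut` import it in a chain; same namespace, all FQNs unchanged.)
# Overbinding budget — «TwinCut»: the cubic cushion cut BY MECHANICAL STATE, and the twin-surgery competitor (decomp-a2c lens-4, generation 77)

Child of `…Theorems.OverbindingBudgetAffineCushionCut` (lens-4 g76, critic row 1334 CLEARED · ADMITTED 76C: slot-3 kernel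
`MR := TameBalancedAffMidGap 64 12 (1/10⁵) (1/25) (3/50) (1/450) ⟸ QH ∧ KF ∧ HI`, transfer target `HexagonalDominance ⟺ KF ∧ HI`,
KF = `CubicCushion` flagged LATERAL with the note «the proof of KF must carry the EXTERIOR CONTROL explicitly: the attractive tail beyond
`r = 12` nn is `≈ 2.9·10⁻⁴ = 4×` the cushion `7.2·10⁻⁵` per site»).  Imports ONLY the g76 tree node and the Literature layer-sum file
`…BarlowCouplingDecay` (for the two instrument literals of §6); restates nothing.

## The lens-4 move of this generation (minimal counterexample / extremal reduction — by SURGERY, not by localisation)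

A minimal counterexample `y` to the cubic cushion KF is STABLE UNDER ZERO-CHARGE SURGERIES `y ↦ y′`: `𝓔(y′) ≥ 𝓔(y) ≥ …`.  The surgery of this
node is the REGISTRY SWAP of two adjacent cubic layers (the upper layer moved in-plane by the local Shockley partial vector `b`, `|b| = nn/√3`,
the lower by `−b`; in Hägg notation the block flip of three consecutive transitions of the stacking literature, `Literature.…BarlowBlockFlipLayers`;
net Burgers content zero): inside a pure-cubic ball it turns `A B C A (B C) A B C` into `A B C A (C B) A B C` — close packing kept at both
contacts, exactly TWO new hexagonal letters — and LOWERS the ideal energy by `−2·J₂ − ∑_{k≥3} ϑ_k J_k ≈ 2Δ` per column (`|ϑ_k| ≤ 4`; `J₂ < 0` the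
hcp preference, `Δ = e(fcc) − e(hcp) ∈ [723, 726]/10⁷`, `…LennardJonesHcpBelowFcc`).  The first variation of a minimal counterexample under this
surgery is an energy DIFFERENCE, so the exterior enters ONLY through (i) registry CONTRASTS across `k ≥ 3` layers in the near field — the
interlayer couplings `J_k = Φ_A(k) − Φ_N(k)` of `…BarlowStackingEnergy`, exponentially small in `k` (instrument literal `StackingBlindness`, §6);
(ii) a RIM FLUX for the far field: for every exterior site `j`, the sum over a moved near-perfect layer patch `P` of `V(· + b − y_j) − V(· − y_j)`
is, up to exponentially small aliasing and `O(ε₁ + θ₀/ρ₁)·∑|V|` corrections (`≈ 10⁻⁷ ≪ |J₂|` per moved site), the boundary term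
`|b| ∮_{∂P} |V(x − y_j)|`, so the WHOLE far field costs `≤ C(δ)` per RIM site — and rims sit in the rebated `¬deep` collar or at the window
boundary (`≤ 18` rim sites per off-window site); (iii) a per-site-BOUNDED influence (`∑_j nn_i |V′(r_ij)| ≤ C(δ)`) of and onto every NON-RIGID
moved or adjacent site — compressed, flex, interface-cubic, `¬deep`, off-window — CHARGED TO THAT SITE'S OWN PRICE OR REBATE (the exchange
currency).  First-order roughness / strain effects on the rigid part couple only to the FORCE and STRESS CONTRASTS of the two ideal stackings
(`≲ 7·|J₂|` per atom, supported on `± 2` layers), i.e. `≲ 10⁻⁷` per column at `(ε₁, θ₀) = (10⁻⁵, 10⁻³)`; the second-order twin-variant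
anisotropy `O(λ_aniso θ₀²) ≲ 2·10⁻⁵ < |J₂|` fixes `θ₀`.  No absolute tail estimate at precision `Δ` is ever needed: the competitor is
EXTERIOR-CONTROLLED BY CONSTRUCTION (`e⋆` is eliminated by the free bulk floor `N e⋆ ≤ 𝓔(y′)`, `floor_le`, applied to the COMPETITOR).
This answers row 1334's concern structurally for the part of KF where it bites (memo §4 has the bookkeeping).

The surgery has teeth exactly on MECHANICALLY SILENT cubic matter — near-rigid (affinely `(12, 1/10⁵, 1/1000)`-deep: two-shell roughness
`≤ 10⁻⁵`, affine distortion `≤ 10⁻³`, so the twin-variant anisotropy term `O(λ_aniso θ²) ≲ 2·10⁻⁵ ≪ 2Δ`) and on-scale (`nn ≥ 17/20`, above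
the sign change of `J₂` under `≈ 21 %` compression) — which is ALSO exactly the matter where no other mechanism offers a local excess.  Hence
the cut of this node: KF is partitioned LOSSLESSLY by the MECHANICAL STATE of the priced site (excluded middle twice on the tree's affine
ladder predicate `AffDeepReg` and once on the scale `nearestDist`):

* **KR** `TameBalancedRigidFccBallGap` / `RigidCubicCushion` («rigid cubic cushion», NEW · UNDECIDED · TRUE-type · WEAKER than KF): `c > 0` per
  `(64, 3/50)`-deep pure-cubic-`12`-ball site that is affinely `(12, 1/10⁵, 1/1000)`-deep with `nn ≥ 17/20`.  ATTACKABLE-L via the competitor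
  TG below (`cubicCushion_of_twinCut`); INSTRUMENTABLE (`IdealTwinGain`, `StackingBlindness`, §6).  HD-only (MR does not need it).
* **KO** `TameBalancedCompressedFccBallGap` / `CompressedCubic` («compressed cubic», NEW · UNDECIDED · TRUE-type · WEAKER than KF): the same sites
  with `nn < 17/20`.  ATTACKABLE-M by CRUDE sitewise localisation: at `nn ≤ 17/20` the twelve compressed first-shell bonds alone lift the site
  energy to `e_i ≳ +0.3`, i.e. `e_i − e⋆ ≳ 1 ≫ 2.9·10⁻⁴` (the whole attractive tail beyond `12` nn, `ρπ/(9R³)` at density `√2`), so here — and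
  only here — row 1334's per-site localisation IS legitimate.  HD-only.
* **KS** `TameBalancedShearedFccBallGap` / `ShearedCubic` («sheared cubic», NEW · UNDECIDED · TRUE-type · WEAKER than KF): pure-cubic-ball deep
  sites affinely `(12, 1/10⁵, 1/25)`-deep but NOT `(12, 1/10⁵, 1/1000)`-deep (smooth, homogeneously distorted by `θ ∈ (10⁻³, 4 %]`).  Local
  excess `Δ + ½λ_min θ² ≥ 7.3·10⁻⁵` but `< tail` for `θ ≲ 1 %`: exterior control by EXCHANGE against the neighbours' own prices (B_aff-type),
  IDEA-NEEDED ∩ INSTRUMENTABLE (census ⑬: `min_{‖F−1‖ ≤ 3/50} e(F·fcc) − e⋆`).  HD-only.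
* **QC** `RoughCubic := TameBalancedFccRoughGap 64 12 (1/10⁵) (1/25) (3/50) (1/450) 12` — g75's cubic leaf OF RECORD, a NAME for the tree
  statement (not restated): the rough / strongly distorted pure-cubic-ball sites.  `MR ⇒ QC` (tree: `cubicRough_of_affMid`, `fccRough_of_cubicRough`),
  so QC is on the WEAKER side of MR — the ONLY cubic-ball piece the record needs.
* **KX** `TameBalancedFlexFccBallGap` / `FlexCubic` («flex cubic», NEW · UNDECIDED · the AND-node KS ∧ QC): pure-cubic-ball deep sites NOT affinely
  `(12, 1/10⁵, 1/1000)`-deep, i.e. g75's `fccRoughCount` at the rigidity tolerance WITHOUT QC's two-letter-ball rebate — TG's exchange currency.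
  `KX ⇒ KS`, `KX ⇒ QC`, `KS ∧ QC ∧ PM ⇒ KX` (PROVED; PM ⟸ HI by g76).
* **TG** `TameTwinGain` / `TwinGain` («twin gain», NEW · UNDECIDED · TRUE-type · LATERAL: a COMPETITOR statement, not a census floor): for every
  window there are `c, C` such that every injective `y` admits a surgery `y′` moving only `12`-deep, cubic-lettered, in-window sites, each by at
  most its own `nn`, with `𝓔(y′) + c·#KR-sites ≤ 𝓔(y) + C·(#KO-sites + #KX-sites + #interfaceCubic + #¬deep + #off + N^{2/3})` — the
  exchange currency being exactly the priced sets of KO, KX and HI.  `TG ∧ KO ∧ KX ∧ HI ⇒ KF`, `TG ∧ KO ∧ KS ∧ QC ∧ HI ⇒ KF` and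
  `⇒ HexagonalDominance` (PROVED: `balancedFccBallGapW_of_twinGainW`, `cubicCushion_of_twinCut`, `hexagonalDominance_of_twinCut`); KF ⇏ TG.

PROVED here (0 sorry): the counting identities (§1); the census algebra ONCE, as `censusW_mono` / `censusW_glue` over an arbitrary priced count
and rebate (g75's `balancedW_mono_core` and g41's `convexComb_core` BY NAME; every census statement of g75/g76/g77 is `CensusW` of its counts by
`Iff.rfl`); the lossless split `KF ⟺ KR ∧ KO ∧ KX` (`cubicCushion_iff_mechanicalStates`) and its refinement of g76's transfer-target split
`HexagonalDominance ⟺ KR ∧ KO ∧ KS ∧ QC ∧ HI` (`hexagonalDominance_iff_fiveLeaves`; the node's ONE EQUIV family); the competitor seam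
`TG ∧ KO ∧ KX ∧ HI ⇒ KF` (`balancedFccBallGapW_of_twinGainW`: bulk floor on the competitor + census glue + one glued exchange); the
`θ`-monotonicity of the affine ladder (`affDeepReg_mono_theta`, `fccRoughCount_anti_theta`); and the record cones BY NAME with the cubic
burden of the record REDUCED to QC: `MR ⟸ QH ∧ QC ∧ HI` (`affMid_record_of_roughCut` = g75's `tameBalancedAffMidGap_of_letterCut` with PM from
g76's HI), `tbdsg_of_roughCut_record`, `rdef_of_ceg_shape_roughCut_record`.

WHY EACH PIECE IS WEAKER / WHERE IT SITS.  KR, KO, KX (hence KS, QC) each price a SUBSET of KF's priced set with KF's rebate (`censusW_mono`):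
KF ⇒ each, and no one of them ⇒ KF (probes).  QC ⟸ MR (tree); KR, KO, KS, KX are NOT implied by MR (they price smooth matter) — they serve
the transfer target only: g76's lateral surplus `KF ∖ QC` is exactly `KR ⊔ KO ⊔ KS`, now typed and separately tagged, and the record's cubic
burden returns to the weaker-side QC with g76's insight kept INSIDE QC's proof plan (QC's rate is the cushion `7.2·10⁻⁵`, not a harmonic
roughness constant).  TG is lateral, and stronger than KR modulo the partners (TG ⇏ KF alone; KF ⇏ TG).

WHY NOVEL (relative to the lineage g35–g76 and the tree).  First COMPETITOR-FORM statement in the OverbindingBudget line: every earlier piece is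
a census FLOOR relative to `N e⋆`, whose proof must control the absolute exterior tail at the precision of its rate; TG compares `y` with a
surgery of itself, so only CONTRASTS and DIFFERENCES enter, and the bulk floor is spent on the competitor.  The surgery (registry swap of two
adjacent layers by opposite Shockley partials, zero net Burgers content) is the tree's `BarlowBlockFlipLayers` move transplanted from ideal infinite stackings to finite registered configurations with an
exchange currency; the typed instruments `IdealTwinGain` / `StackingBlindness` (§6) name precisely the «fcc−hcp lattice-sum difference beyond
12 nn negligible» of row 1334 as statements about `barlowCoupling lennardJones` (the tree's `…BarlowCouplingDecay` gives only the algebraic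
`|J_k| ≤ 2C k⁻⁴`, insufficient for a sign; the true rate is `e^{−(4π√2/3)k} ≈ (2.7·10⁻³)^k`).

DEAD ENDS recorded (memo §5): sitewise / regional Cauchy–Born floors for KF (a dense registered exterior lowers `∑_Ω e_i` by `≈ 0.036` per
interface site ≫ `TΔ`); range cut KF ⟸ near(R) ∧ tail (tail piece false standalone); `e⋆ ↦ e(hcp₀)` (non-ideal `c/a`); a bare competitor for
ALL of KF (restacking LOSES on sheared smooth fcc — twin-variant anisotropy `O(λ_aniso θ²)` up to `10⁻²` per site at `θ = 4 %` — and on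
compressed fcc, `J₂ > 0` below `≈ 0.77` absolute scale); `ℤ/3`-averaging over Shockley directions (all three give the same point set);
smeared flips (the annulus sits on the unstable-stacking barrier `γ_us ≫ Δ`: rims must be sharp and placed in the rebated `¬deep` collar);
smoothing surgery for ROUGH fcc (bilinear cross term with the exterior displacement `≈ 4·10⁻⁴` per boundary pair ≫ roughness energy).
-/

namespace Summit.AtomisticToContinuum.Crystallization.Theorems.OverbindingBudgetAffineTwinCut

open scoped BigOperators Classical
open Literature.MathematicalPhysics.StatisticalMechanics
open Literature.Geometry.DiscreteGeometry (IsChargeFree nearestDist nearestDist_nonneg nearestDist_le_dist fccTwoShellPattern hcpTwoShellPattern)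
open Summit.AtomisticToContinuum.Crystallization.Theorems.OverbindingBudgetMisfitRegistration (Framed Reg DeepReg)
open Summit.AtomisticToContinuum.Crystallization.Theorems.OverbindingBudgetMisfitWindowStatements (InWindow offCount)
open Summit.AtomisticToContinuum.Crystallization.Theorems.OverbindingBudgetBalancedCensusStatements
open Summit.AtomisticToContinuum.Crystallization.Theorems.OverbindingBudgetHarmonicNormalForm (convexComb_core)
open Summit.AtomisticToContinuum.Crystallization.Theorems.OverbindingBudgetAffineLadder
open Summit.AtomisticToContinuum.Crystallization.Theorems.OverbindingBudgetAffineMesoCut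
open Summit.AtomisticToContinuum.Crystallization.Theorems.OverbindingBudgetAffinePhaseCut
open Summit.AtomisticToContinuum.Crystallization.Theorems.OverbindingBudgetAffineCushionCut

variable {N : ℕ}

local notation "E3" => EuclideanSpace ℝ (Fin 3)

/-! ## §1  Mechanical states of a pure-cubic-ball site: three new counts and the counting identities (PROVED) -/

/-- Number of RIGID pure-cubic-ball deep sites at scale `≥ s₁`: `(ρ, ε)`-deep, affinely `(ρ₁, ε₁, θ₀)`-deep (near-rigid), `s₁ ≤ nn`, a cubic letter
within `r·nn`, no hexagonal letter within `r·nn` (the priced set of KR and the gain set of TG). -/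
noncomputable def rigidFccBallCount (ρ ρ₁ ε₁ θ₀ s₁ ε g r : ℝ) (y : Fin N → E3) : ℕ :=
  Nat.card {i : Fin N // (DeepReg ρ ε g y i ∧ AffDeepReg ρ₁ ε₁ θ₀ g y i ∧ s₁ ≤ nearestDist y i) ∧ CNear r ε g y i ∧ ¬ HNear r ε g y i}

/-- Number of COMPRESSED rigid pure-cubic-ball deep sites: as `rigidFccBallCount` but with `nn < s₁` (the priced set of KO). -/
noncomputable def compressedFccBallCount (ρ ρ₁ ε₁ θ₀ s₁ ε g r : ℝ) (y : Fin N → E3) : ℕ :=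
  Nat.card {i : Fin N // (DeepReg ρ ε g y i ∧ AffDeepReg ρ₁ ε₁ θ₀ g y i ∧ nearestDist y i < s₁) ∧ CNear r ε g y i ∧ ¬ HNear r ε g y i}

/-- Number of SHEARED smooth pure-cubic-ball deep sites: `(ρ, ε)`-deep, affinely `(ρ₁, ε₁, θ)`-deep but NOT affinely `(ρ₁, ε₁, θ₀)`-deep (smooth
with affine distortion between `θ₀` and `θ`), pure-cubic `r`-ball (the priced set of KS). -/
noncomputable def shearedFccBallCount (ρ ρ₁ ε₁ θ₀ θ ε g r : ℝ) (y : Fin N → E3) : ℕ :=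
  Nat.card {i : Fin N // (DeepReg ρ ε g y i ∧ AffDeepReg ρ₁ ε₁ θ g y i ∧ ¬ AffDeepReg ρ₁ ε₁ θ₀ g y i) ∧ CNear r ε g y i ∧ ¬ HNear r ε g y i}

/-- The affine ladder is MONOTONE in the distortion tolerance: `AffFramed ε θ₀ g ⇒ AffFramed ε θ g` for `θ₀ ≤ θ`. [this file] -/
theorem affFramed_mono_theta {ε θ₀ θ g : ℝ} (hθ : θ₀ ≤ θ) {y : Fin N → E3} {i : Fin N} (h : AffFramed ε θ₀ g y i) : AffFramed ε θ g y i := by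
  obtain ⟨Q, A, P, f, hP, hAQ, hf, hinj, hcov⟩ := h
  exact ⟨Q, A, P, f, hP, fun v hv => (hAQ v hv).trans hθ, hf, hinj, hcov⟩

/-- `AffReg ε θ₀ g ⇒ AffReg ε θ g` for `θ₀ ≤ θ`. [this file] -/
theorem affReg_mono_theta {ε θ₀ θ g : ℝ} (hθ : θ₀ ≤ θ) {y : Fin N → E3} {i : Fin N} (h : AffReg ε θ₀ g y i) : AffReg ε θ g y i :=
  ⟨h.1, affFramed_mono_theta hθ h.2⟩

/-- `AffDeepReg ρ ε θ₀ g ⇒ AffDeepReg ρ ε θ g` for `θ₀ ≤ θ`. [this file] -/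
theorem affDeepReg_mono_theta {ρ ε θ₀ θ g : ℝ} (hθ : θ₀ ≤ θ) {y : Fin N → E3} {i : Fin N} (h : AffDeepReg ρ ε θ₀ g y i) :
    AffDeepReg ρ ε θ g y i :=
  fun i' hi' => affReg_mono_theta hθ (h i' hi')

/-- EXCLUDED MIDDLE ON THE MECHANICAL STATE: `#fccBall ≤ #rigid + #compressed + #flex(θ₀)` (a pure-cubic-ball deep site is near-rigid at scale
`≥ s₁`, near-rigid at scale `< s₁`, or not near-rigid). [this file] -/
theorem fccBallCount_le_rigid_add_compressed_add_fccRough {ρ ρ₁ ε₁ θ₀ s₁ ε g r : ℝ} (y : Fin N → E3) :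
    fccBallCount ρ ε g r y ≤ rigidFccBallCount ρ ρ₁ ε₁ θ₀ s₁ ε g r y + compressedFccBallCount ρ ρ₁ ε₁ θ₀ s₁ ε g r y
      + fccRoughCount ρ ρ₁ ε₁ θ₀ ε g r y := by
  simp only [fccBallCount, rigidFccBallCount, compressedFccBallCount, fccRoughCount, Nat.card_eq_fintype_card, Fintype.card_subtype]
  calc (Finset.univ.filter fun i => DeepReg ρ ε g y i ∧ CNear r ε g y i ∧ ¬ HNear r ε g y i).card
      ≤ (((Finset.univ.filter fun i =>
            (DeepReg ρ ε g y i ∧ AffDeepReg ρ₁ ε₁ θ₀ g y i ∧ s₁ ≤ nearestDist y i) ∧ CNear r ε g y i ∧ ¬ HNear r ε g y i) ∪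
          (Finset.univ.filter fun i =>
            (DeepReg ρ ε g y i ∧ AffDeepReg ρ₁ ε₁ θ₀ g y i ∧ nearestDist y i < s₁) ∧ CNear r ε g y i ∧ ¬ HNear r ε g y i)) ∪
          (Finset.univ.filter fun i => (DeepReg ρ ε g y i ∧ ¬ AffDeepReg ρ₁ ε₁ θ₀ g y i) ∧ CNear r ε g y i ∧ ¬ HNear r ε g y i)).card := by
        apply Finset.card_le_card
        intro i hi
        rw [Finset.mem_filter] at hi
        simp only [Finset.mem_union, Finset.mem_filter]
        by_cases hA : AffDeepReg ρ₁ ε₁ θ₀ g y i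
        · by_cases hs : s₁ ≤ nearestDist y i
          · exact Or.inl (Or.inl ⟨hi.1, ⟨hi.2.1, hA, hs⟩, hi.2.2.1, hi.2.2.2⟩)
          · exact Or.inl (Or.inr ⟨hi.1, ⟨hi.2.1, hA, lt_of_not_ge hs⟩, hi.2.2.1, hi.2.2.2⟩)
        · exact Or.inr ⟨hi.1, ⟨hi.2.1, hA⟩, hi.2.2.1, hi.2.2.2⟩
    _ ≤ _ := (Finset.card_union_le _ _).trans (Nat.add_le_add_right (Finset.card_union_le _ _) _)

/-- `#rigid ≤ #fccBall`. [this file] -/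
theorem rigidFccBallCount_le_fccBallCount {ρ ρ₁ ε₁ θ₀ s₁ ε g r : ℝ} (y : Fin N → E3) :
    rigidFccBallCount ρ ρ₁ ε₁ θ₀ s₁ ε g r y ≤ fccBallCount ρ ε g r y := by
  simp only [rigidFccBallCount, fccBallCount, Nat.card_eq_fintype_card, Fintype.card_subtype]
  apply Finset.card_le_card
  intro i hi
  rw [Finset.mem_filter] at hi ⊢
  exact ⟨hi.1, hi.2.1.1, hi.2.2⟩

/-- `#compressed ≤ #fccBall`. [this file] -/
theorem compressedFccBallCount_le_fccBallCount {ρ ρ₁ ε₁ θ₀ s₁ ε g r : ℝ} (y : Fin N → E3) :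
    compressedFccBallCount ρ ρ₁ ε₁ θ₀ s₁ ε g r y ≤ fccBallCount ρ ε g r y := by
  simp only [compressedFccBallCount, fccBallCount, Nat.card_eq_fintype_card, Fintype.card_subtype]
  apply Finset.card_le_card
  intro i hi
  rw [Finset.mem_filter] at hi ⊢
  exact ⟨hi.1, hi.2.1.1, hi.2.2⟩

/-- `#sheared(θ₀, θ) ≤ #flex(θ₀)` (`= fccRoughCount` at `θ₀`). [this file] -/
theorem shearedFccBallCount_le_fccRoughCount {ρ ρ₁ ε₁ θ₀ θ ε g r : ℝ} (y : Fin N → E3) :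
    shearedFccBallCount ρ ρ₁ ε₁ θ₀ θ ε g r y ≤ fccRoughCount ρ ρ₁ ε₁ θ₀ ε g r y := by
  simp only [shearedFccBallCount, fccRoughCount, Nat.card_eq_fintype_card, Fintype.card_subtype]
  apply Finset.card_le_card
  intro i hi
  rw [Finset.mem_filter] at hi ⊢
  exact ⟨hi.1, ⟨hi.2.1.1, hi.2.1.2.2⟩, hi.2.2⟩

/-- `#sheared ≤ #fccBall`. [this file] -/
theorem shearedFccBallCount_le_fccBallCount {ρ ρ₁ ε₁ θ₀ θ ε g r : ℝ} (y : Fin N → E3) :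
    shearedFccBallCount ρ ρ₁ ε₁ θ₀ θ ε g r y ≤ fccBallCount ρ ε g r y :=
  (shearedFccBallCount_le_fccRoughCount y).trans (fccRoughCount_le_fccBallCount y)

/-- `θ`-MONOTONICITY OF THE ROUGH COUNT: `#fccRough(θ) ≤ #fccRough(θ₀)` for `θ₀ ≤ θ` (larger tolerance, fewer non-affinely-deep sites). [this file] -/
theorem fccRoughCount_anti_theta {ρ ρ₁ ε₁ θ₀ θ ε g r : ℝ} (hθ : θ₀ ≤ θ) (y : Fin N → E3) :
    fccRoughCount ρ ρ₁ ε₁ θ ε g r y ≤ fccRoughCount ρ ρ₁ ε₁ θ₀ ε g r y := by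
  simp only [fccRoughCount, Nat.card_eq_fintype_card, Fintype.card_subtype]
  apply Finset.card_le_card
  intro i hi
  rw [Finset.mem_filter] at hi ⊢
  exact ⟨hi.1, ⟨hi.2.1.1, fun hA => hi.2.1.2 (affDeepReg_mono_theta hθ hA)⟩, hi.2.2⟩

/-- EXCLUDED MIDDLE ON THE DISTORTION: `#flex(θ₀) ≤ #sheared(θ₀, θ) + #fccRough(θ)`. [this file] -/
theorem fccRoughCount_le_sheared_add_fccRough {ρ ρ₁ ε₁ θ₀ θ ε g r : ℝ} (y : Fin N → E3) :
    fccRoughCount ρ ρ₁ ε₁ θ₀ ε g r y ≤ shearedFccBallCount ρ ρ₁ ε₁ θ₀ θ ε g r y + fccRoughCount ρ ρ₁ ε₁ θ ε g r y := by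
  simp only [shearedFccBallCount, fccRoughCount, Nat.card_eq_fintype_card, Fintype.card_subtype]
  calc (Finset.univ.filter fun i => (DeepReg ρ ε g y i ∧ ¬ AffDeepReg ρ₁ ε₁ θ₀ g y i) ∧ CNear r ε g y i ∧ ¬ HNear r ε g y i).card
      ≤ ((Finset.univ.filter fun i =>
            (DeepReg ρ ε g y i ∧ AffDeepReg ρ₁ ε₁ θ g y i ∧ ¬ AffDeepReg ρ₁ ε₁ θ₀ g y i) ∧ CNear r ε g y i ∧ ¬ HNear r ε g y i) ∪
          (Finset.univ.filter fun i => (DeepReg ρ ε g y i ∧ ¬ AffDeepReg ρ₁ ε₁ θ g y i) ∧ CNear r ε g y i ∧ ¬ HNear r ε g y i)).card := by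
        apply Finset.card_le_card
        intro i hi
        rw [Finset.mem_filter] at hi
        rw [Finset.mem_union, Finset.mem_filter, Finset.mem_filter]
        by_cases hA : AffDeepReg ρ₁ ε₁ θ g y i
        · exact Or.inl ⟨hi.1, ⟨hi.2.1.1, hA, hi.2.1.2⟩, hi.2.2⟩
        · exact Or.inr ⟨hi.1, ⟨hi.2.1.1, hA⟩, hi.2.2⟩
    _ ≤ _ := Finset.card_union_le _ _

/-! ## §2  THE STATEMENTS OF THE CUT (census shape of the tree; NEW, UNDECIDED) and the COMPETITOR statement TG -/

/-- **KR_W** («rigid cubic cushion», one window): `c > 0` per `(ρ, ε)`-deep pure-cubic-`r`-ball site that is affinely `(ρ₁, ε₁, θ₀)`-deep with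
`s₁ ≤ nn`, against `#¬(ρ,ε)-deep + #off + N^{2/3} + gains`. [this file · kind: statement] -/
def BalancedRigidFccBallGapW (ρ ρ₁ ε₁ θ₀ s₁ ε g r σ₁ σ₂ : ℝ) : Prop :=
  ∃ c C : ℝ, 0 < c ∧ ∀ (N : ℕ) (y : Fin N → E3), Function.Injective y →
    ∃ u : E3, ‖u‖ = 1 ∧
      (N : ℝ) * (⨅ Q : PeriodicConfiguration 3, Q.energyPerParticle lennardJones) + c * (rigidFccBallCount ρ ρ₁ ε₁ θ₀ s₁ ε g r y : ℝ)
        - C * (notDeepCount ρ ε g y : ℝ) - C * (offCount σ₁ σ₂ y : ℝ) - C * (N : ℝ) ^ (2 / 3 : ℝ) - C * (dilGain y + shGain u y)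
        ≤ interactionEnergy lennardJones y

/-- **KR** (tame): `BalancedRigidFccBallGapW … δ 2` for every window `[δ, 2]`, `0 < δ ≤ 2`. -/
def TameBalancedRigidFccBallGap (ρ ρ₁ ε₁ θ₀ s₁ ε g r : ℝ) : Prop :=
  ∀ δ : ℝ, 0 < δ → δ ≤ 2 → BalancedRigidFccBallGapW ρ ρ₁ ε₁ θ₀ s₁ ε g r δ 2

/-- **`RigidCubicCushion`** — KR at the frame of record `(64, 12, 1/10⁵, 1/1000, 17/20, 3/50, 1/450, 12)`. [this file · kind: statement] -/
def RigidCubicCushion : Prop :=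
  TameBalancedRigidFccBallGap 64 12 (1 / 10 ^ 5) (1 / 1000) (17 / 20) (3 / 50) (1 / 450) 12

/-- **KO_W** («compressed cubic», one window): `c > 0` per `(ρ, ε)`-deep pure-cubic-`r`-ball site that is affinely `(ρ₁, ε₁, θ₀)`-deep with
`nn < s₁`, against `#¬(ρ,ε)-deep + #off + N^{2/3} + gains`. [this file · kind: statement] -/
def BalancedCompressedFccBallGapW (ρ ρ₁ ε₁ θ₀ s₁ ε g r σ₁ σ₂ : ℝ) : Prop :=
  ∃ c C : ℝ, 0 < c ∧ ∀ (N : ℕ) (y : Fin N → E3), Function.Injective y →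
    ∃ u : E3, ‖u‖ = 1 ∧
      (N : ℝ) * (⨅ Q : PeriodicConfiguration 3, Q.energyPerParticle lennardJones) + c * (compressedFccBallCount ρ ρ₁ ε₁ θ₀ s₁ ε g r y : ℝ)
        - C * (notDeepCount ρ ε g y : ℝ) - C * (offCount σ₁ σ₂ y : ℝ) - C * (N : ℝ) ^ (2 / 3 : ℝ) - C * (dilGain y + shGain u y)
        ≤ interactionEnergy lennardJones y

/-- **KO** (tame). -/
def TameBalancedCompressedFccBallGap (ρ ρ₁ ε₁ θ₀ s₁ ε g r : ℝ) : Prop :=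
  ∀ δ : ℝ, 0 < δ → δ ≤ 2 → BalancedCompressedFccBallGapW ρ ρ₁ ε₁ θ₀ s₁ ε g r δ 2

/-- **`CompressedCubic`** — KO at the frame of record. [this file · kind: statement] -/
def CompressedCubic : Prop :=
  TameBalancedCompressedFccBallGap 64 12 (1 / 10 ^ 5) (1 / 1000) (17 / 20) (3 / 50) (1 / 450) 12

/-- **KS_W** («sheared cubic», one window): `c > 0` per `(ρ, ε)`-deep pure-cubic-`r`-ball site that is affinely `(ρ₁, ε₁, θ)`-deep but not
affinely `(ρ₁, ε₁, θ₀)`-deep, against `#¬(ρ,ε)-deep + #off + N^{2/3} + gains`. [this file · kind: statement] -/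
def BalancedShearedFccBallGapW (ρ ρ₁ ε₁ θ₀ θ ε g r σ₁ σ₂ : ℝ) : Prop :=
  ∃ c C : ℝ, 0 < c ∧ ∀ (N : ℕ) (y : Fin N → E3), Function.Injective y →
    ∃ u : E3, ‖u‖ = 1 ∧
      (N : ℝ) * (⨅ Q : PeriodicConfiguration 3, Q.energyPerParticle lennardJones) + c * (shearedFccBallCount ρ ρ₁ ε₁ θ₀ θ ε g r y : ℝ)
        - C * (notDeepCount ρ ε g y : ℝ) - C * (offCount σ₁ σ₂ y : ℝ) - C * (N : ℝ) ^ (2 / 3 : ℝ) - C * (dilGain y + shGain u y)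
        ≤ interactionEnergy lennardJones y

/-- **KS** (tame). -/
def TameBalancedShearedFccBallGap (ρ ρ₁ ε₁ θ₀ θ ε g r : ℝ) : Prop :=
  ∀ δ : ℝ, 0 < δ → δ ≤ 2 → BalancedShearedFccBallGapW ρ ρ₁ ε₁ θ₀ θ ε g r δ 2

/-- **`ShearedCubic`** — KS at the frame of record `(64, 12, 1/10⁵, 1/1000, 1/25, 3/50, 1/450, 12)`. [this file · kind: statement] -/
def ShearedCubic : Prop :=
  TameBalancedShearedFccBallGap 64 12 (1 / 10 ^ 5) (1 / 1000) (1 / 25) (3 / 50) (1 / 450) 12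

/-- **`RoughCubic`** — a NAME for g75's cubic leaf of record QC (`TameBalancedFccRoughGap` of `…AffinePhaseCut`, not restated): the rough or
strongly distorted pure-cubic-ball deep sites pay (rebate `#¬deep + #mixedRough`).  On the WEAKER side of MR. [`…AffinePhaseCut` · kind: statement] -/
def RoughCubic : Prop :=
  TameBalancedFccRoughGap 64 12 (1 / 10 ^ 5) (1 / 25) (3 / 50) (1 / 450) 12

/-- **KX_W** («flex cubic», one window): `c > 0` per `(ρ, ε)`-deep pure-cubic-`r`-ball site that is NOT affinely `(ρ₁, ε₁, θ₀)`-deep (rough OR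
distorted beyond the rigidity tolerance `θ₀`: the union KS ⊔ QC), against `#¬(ρ,ε)-deep + #off + N^{2/3} + gains` — g75's `fccRoughCount` at `θ₀`
WITHOUT the two-letter-ball rebate of QC (TG's exchange currency). [this file · kind: statement] -/
def BalancedFlexFccBallGapW (ρ ρ₁ ε₁ θ₀ ε g r σ₁ σ₂ : ℝ) : Prop :=
  ∃ c C : ℝ, 0 < c ∧ ∀ (N : ℕ) (y : Fin N → E3), Function.Injective y →
    ∃ u : E3, ‖u‖ = 1 ∧
      (N : ℝ) * (⨅ Q : PeriodicConfiguration 3, Q.energyPerParticle lennardJones) + c * (fccRoughCount ρ ρ₁ ε₁ θ₀ ε g r y : ℝ)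
        - C * (notDeepCount ρ ε g y : ℝ) - C * (offCount σ₁ σ₂ y : ℝ) - C * (N : ℝ) ^ (2 / 3 : ℝ) - C * (dilGain y + shGain u y)
        ≤ interactionEnergy lennardJones y

/-- **KX** (tame). -/
def TameBalancedFlexFccBallGap (ρ ρ₁ ε₁ θ₀ ε g r : ℝ) : Prop :=
  ∀ δ : ℝ, 0 < δ → δ ≤ 2 → BalancedFlexFccBallGapW ρ ρ₁ ε₁ θ₀ ε g r δ 2

/-- **`FlexCubic`** — KX at the frame of record `(64, 12, 1/10⁵, 1/1000, 3/50, 1/450, 12)` (the AND-node KS ∧ QC of this file). [this file · kind: statement] -/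
def FlexCubic : Prop :=
  TameBalancedFlexFccBallGap 64 12 (1 / 10 ^ 5) (1 / 1000) (3 / 50) (1 / 450) 12

/-- **TG_W** («twin gain», one window; a COMPETITOR statement): there are `c > 0`, `C` such that every injective `y` admits a surgery `y′` —
injective, moving only `(r, ε)`-deeply registered CUBIC-lettered IN-WINDOW sites, each by at most its own nearest-neighbour distance — with
`𝓔(y′) + c·#rigid ≤ 𝓔(y) + C·(#compressed + #flex(θ₀) + #interfaceCubic) + C·#¬(ρ,ε)-deep + C·#off + C·N^{2/3}`.
Intended witness: the REGISTRY SWAP of two adjacent cubic layers — the upper moved in-plane by the local Shockley partial vector `b`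
(`|b| = nn/√3`), the lower by `−b`, i.e. `A B C A (B C) A B C ↦ A B C A (C B) A B C`: close packing is kept at both contacts and two
hexagonal letters appear (in Hägg notation the block flip of three consecutive transitions — the tree's `BarlowBlockFlipLayers` move) — one
swap every `6` layers, `≥ 4` layers inside each cubic run, on whole registered layer components with the locally adapted `b` (rims in the
`¬deep` collar or at the window boundary). [this file · kind: statement] -/
def TwinGainW (ρ ρ₁ ε₁ θ₀ s₁ ε g r σ₁ σ₂ : ℝ) : Prop :=
  ∃ c C : ℝ, 0 < c ∧ ∀ (N : ℕ) (y : Fin N → E3), Function.Injective y →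
    ∃ y' : Fin N → E3, Function.Injective y' ∧
      (∀ i : Fin N, y' i ≠ y i →
        (DeepReg r ε g y i ∧ CFramed ε g y i ∧ InWindow σ₁ σ₂ y i) ∧ dist (y' i) (y i) ≤ nearestDist y i) ∧
      interactionEnergy lennardJones y' + c * (rigidFccBallCount ρ ρ₁ ε₁ θ₀ s₁ ε g r y : ℝ)
        ≤ interactionEnergy lennardJones y
          + C * ((compressedFccBallCount ρ ρ₁ ε₁ θ₀ s₁ ε g r y + fccRoughCount ρ ρ₁ ε₁ θ₀ ε g r y + interfaceCubicCount ρ ε g r y : ℕ) : ℝ)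
          + C * (notDeepCount ρ ε g y : ℝ) + C * (offCount σ₁ σ₂ y : ℝ) + C * (N : ℝ) ^ (2 / 3 : ℝ)

/-- **TG** (tame): `TwinGainW … δ 2` for every window `[δ, 2]`, `0 < δ ≤ 2` (the constants may depend on `δ`). -/
def TameTwinGain (ρ ρ₁ ε₁ θ₀ s₁ ε g r : ℝ) : Prop :=
  ∀ δ : ℝ, 0 < δ → δ ≤ 2 → TwinGainW ρ ρ₁ ε₁ θ₀ s₁ ε g r δ 2

/-- **`TwinGain`** — TG at the frame of record `(64, 12, 1/10⁵, 1/1000, 17/20, 3/50, 1/450, 12)`. [this file · kind: statement] -/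
def TwinGain : Prop :=
  TameTwinGain 64 12 (1 / 10 ^ 5) (1 / 1000) (17 / 20) (3 / 50) (1 / 450) 12

end Summit.AtomisticToContinuum.Crystallization.Theorems.OverbindingBudgetAffineTwinCut
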